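import Summits.BirchSwinnertonDyer.BirchSwinnertonDyer.Theorems.ThetaPartnerAtTwoSignedControlAtTwoShaTwoPrimaryVanishing
import Summits.BirchSwinnertonDyer.BirchSwinnertonDyer.Theorems.ThetaPartnerAtTwoSignedControlAtTwoArchMovesTwoTorsion
import Summits.BirchSwinnertonDyer.BirchSwinnertonDyer.Theses.ThetaPartnerAtTwo
import Summits.BirchSwinnertonDyer.BirchSwinnertonDyer.Theses.ResidualThetaTransportAtTwo
import Summits.BirchSwinnertonDyer.BirchSwinnertonDyer.Theorems.ThetaPartnerAtTwoSignedControlAtTwoCasselsOfPT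
import Summits.BirchSwinnertonDyer.BirchSwinnertonDyer.Theorems.ThetaPartnerAtTwoSignedControlAtTwoCoinvOfResTwo
import Literature.NumberTheory.EllipticCurves.SelmerCorankProofs
import HarnessLib

/-!
# `Ш²(ℚ, E[2^∞]) = 0` and the K4 body from {PT(b), PT(a)} ALONE on the sub-row «complex conjugation moves `E[2]`»
# (K4 `SignedControlAtTwo`, line `eulerchar` v12: the two archimedean stubs discharged at the consumed module)

Crux K4 `SignedControlAtTwo` (stmt-BirchSwinnertonDyer-20309; routes `ThetaPartnerAtTwo` / `ResidualThetaTransportAtTwo`),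
line `eulerchar` v12 (four generic Poitou–Tate stubs over `ℚ`); width seat `bsd-wall-tp2-p3-w3` g8
(`--supports stmt-BirchSwinnertonDyer-20309`, helper).

The registered composition consumes the archimedean stubs `stub_poitouTateThreeRealRat` (Milne I 4.10 (c), `r = 3`) and
`stub_poitouTateTwoRealRat` (Cor. 4.16) only inside `SignedEC.ShaTwo.exists_nsmul_eq_of_mem_shaTwo`, and there only at the
module `E[2]`.  §1 re-runs that proof VERBATIM with the two facts weakened to their instances at `E[p]`
(`exists_nsmul_eq_of_mem_shaTwo_at`, `forall_mem_shaTwo_primary_eq_zero_at`); §2 discharges both instances over `ℚ` at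
`p = 2` on the sub-row «the archimedean decomposition group `Γ_{ℚ_∞}` moves `E[2]`» (⟺ `Δ(E) < 0`) by
`SignedEC.ArchMoves.threeRealPlaces_twoTorsion_of_moves` / `twoRealPlaces_twoTorsion_of_moves` (`H³(ℚ, E[2]) = 0` via Shapiro +
`cd₂(ℚ(E[2])) ≤ 2`; `H²(ℚ_∞, E[2]) = 0`), giving **`forall_mem_shaTwo_two_primary_eq_zero_of_goodSS_of_moves`**:
`Ш²(ℚ, E[2^∞]) = 0` on that sub-row from `poitouTate_sha_tateDual ℚ` ALONE; §3 is the K4 door on the sub-row: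
**`signedControl_body_of_moves`** — both conjuncts of the crux body for every curve of the row with `Γ_{ℚ_∞}` moving
`E[2]`, from the TWO generic stubs `poitouTate_selmerStructure_duality ℚ` (PT(b), via Cassels) and `poitouTate_sha_tateDual ℚ`
(PT(a), counting) — the archimedean residue of skeleton v12 is EMPTY there.

HONEST FRAMING: THEOREMS only (no definition, no named fact, no `sorry`); CONDITIONAL on the two cited Poitou–Tate facts
(hypotheses by name) and on the sub-row hypothesis `hmove`; on the complementary sub-row (`Δ > 0`: `ℚ(E[2])` totally real)
the archimedean stubs remain cited; closes no item; BSD is not proved by any of this.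

References: [MilneADT2006] I Thm. 4.10 (a)(c), Cor. 4.16, Lemma 6.12, Thm. 6.13 (c); [SerreGaloisCohomology1997] I §2.5,
II §4.4 Prop. 13; [GreenbergLNM1716] §4 p. 119; [BDKim2013] Cor. 3.15; [Kobayashi2003] Thm. 1.2.
-/

set_option autoImplicit false
-- the Theorems namespace of this sub repeats the summit name by design (D-0017 nested layout)
set_option linter.dupNamespace false

noncomputable section

open scoped NumberField ContRepresentation

open CategoryTheory NumberField IsDedekindDomain Field Function WeierstrassCurve
open _root_.TopRep _root_.ContRepresentation _root_.ContinuousCohomology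
open Literature.NumberTheory.EllipticCurves Literature.NumberTheory.GaloisRepresentations
open Literature.NumberTheory.GaloisRepresentations.DiscreteGaloisModule (sha shaTwo mem_sha_iff mem_shaTwo_iff tateDual)
open Literature.NumberTheory.GaloisCohomology
open Summit.BirchSwinnertonDyer.Rank1Residual.X11b (LocBridge.primaryGaloisModule)
open Summit.BirchSwinnertonDyer.Rank1Residual.X11b.Levels (primaryInclusion)
open Summit.BirchSwinnertonDyer.BirchSwinnertonDyer.Theorems.SignedEC.ShaTwo

namespace Summit.BirchSwinnertonDyer.BirchSwinnertonDyer.Theorems.SignedEC.ShaTwoArchMoves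

/-! ## §1 The halving and the vanishing of `Ш²(K, E[p^∞])` with the archimedean facts AT `E[p]` -/

section Divisible

variable {K : Type} [Field K] [NumberField K] (W : WeierstrassCurve K) [W.IsElliptic] (p : ℕ) [Fact p.Prime]

/-- **Halving in `Ш²(K, E[p^∞])`, `K` totally real, with the two archimedean Poitou–Tate rows assumed ONLY AT `E[p]`**
(`h3`: a class of `H³(K, E[p])` dying at the infinite places is `0`; `h2`: every family of classes in `H²(K_w, E[p])` is
realised by a global class at the real places) — otherwise VERBATIM `SignedEC.ShaTwo.exists_nsmul_eq_of_mem_shaTwo` (Milne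
*ADT* I Lemma 6.12 / Thm. 6.13 (c) inside `Ш²`). [cite: MilneADT2006, Ch. I, Thm. 4.10 (c), Cor. 4.16, Lemma 6.12, Thm. 6.13 (c)] -/
theorem exists_nsmul_eq_of_mem_shaTwo_at [IsTotallyReal K]
    (h3 : ∀ c : galoisCohomology (W.torsionGaloisModule ((p : ℕ) : ℤ)) 3,
      (∀ w : InfinitePlace K, galoisCohomology.localization (W.torsionGaloisModule ((p : ℕ) : ℤ)) (Sum.inl w) 3 c = 0) →
        c = 0)
    (h2 : ∀ r : ∀ w : InfinitePlace K, galoisCohomology ((W.torsionGaloisModule ((p : ℕ) : ℤ)).toLocal (Sum.inl w)) 2,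
      ∃ c : galoisCohomology (W.torsionGaloisModule ((p : ℕ) : ℤ)) 2,
        ∀ w : InfinitePlace K, w.IsReal →
          galoisCohomology.localization (W.torsionGaloisModule ((p : ℕ) : ℤ)) (Sum.inl w) 2 c = r w)
    (hfin : ∀ (v : HeightOneSpectrum (𝓞 K))
      (Z : galoisCohomology ((LocBridge.primaryGaloisModule W p).toLocal (Sum.inr v)) 2), Z = 0)
    (c : galoisCohomology (LocBridge.primaryGaloisModule W p) 2) (hc : c ∈ shaTwo (LocBridge.primaryGaloisModule W p)) :
    ∃ c' ∈ shaTwo (LocBridge.primaryGaloisModule W p), p • c' = c := by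
  haveI : NeZero p := ⟨(Fact.out : p.Prime).ne_zero⟩
  haveI : Finite (W.geomTorsion ((p : ℕ) : ℤ)) := finite_geomTorsion_of_neZero W p
  haveI : CompactSpace (absoluteGaloisGroup K) := absoluteGaloisGroup_compactSpace K
  obtain ⟨M, -, z, hz, rfl⟩ := exists_mem_shaTwo_map_primaryInclusion_eq W p c hc
  have hses := isSES_torsionInclusion_levelMul W p M
  obtain ⟨y, hy⟩ := IsSES.exists_map_two_eq_of_forall_localization_inl hses
    (fun c hc ↦ h3 c hc) z
    (fun w ↦ (mem_shaTwo_iff _ _).1 hz (Sum.inl w))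
  rw [DiscreteGaloisModule.cohomologyMap_homOfIntertwining] at hy
  have hloc : ∀ w : InfinitePlace K,
      ∃ r : galoisCohomology ((W.torsionGaloisModule ((p : ℕ) : ℤ)).toLocal (Sum.inl w)) 2,
        galoisCohomology.map ((W.torsionInclusion (natCast_dvd_pow_succ_cast p M)).restrictField w.Completion) 2 r =
          galoisCohomology.localization (W.torsionGaloisModule ((p ^ (M + 1) : ℕ) : ℤ)) (Sum.inl w) 2 y := by
    intro w
    haveI : CompactSpace (absoluteGaloisGroup (Place.Completion (Sum.inl w : Place K))) :=
      absoluteGaloisGroup_compactSpace _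
    haveI : CompactSpace (absoluteGaloisGroup w.Completion) := absoluteGaloisGroup_compactSpace _
    have hw : galoisCohomology.map
        ((Summit.BirchSwinnertonDyer.Rank1Residual.X11b.Levels.levelMul W p M 1).restrictField w.Completion) 2
          (galoisCohomology.localization (W.torsionGaloisModule ((p ^ (M + 1) : ℕ) : ℤ)) (Sum.inl w) 2 y) = 0 := by
      rw [← localization_inl_map_two, hy]
      exact (mem_shaTwo_iff _ _).1 hz (Sum.inl w)
    exact (hses.restrictField w.Completion).exists_map_two_eq_of_map_two_eq_zero _ hw
  choose r hr using hloc
  obtain ⟨c₀, hc₀⟩ := h2 r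
  set y₁ := y - galoisCohomology.map (W.torsionInclusion (natCast_dvd_pow_succ_cast p M)) 2 c₀ with hy₁
  have hy₁z : galoisCohomology.map (Summit.BirchSwinnertonDyer.Rank1Residual.X11b.Levels.levelMul W p M 1) 2 y₁ = z := by
    rw [hy₁, map_sub, hy, ← DiscreteGaloisModule.cohomologyMap_homOfIntertwining,
      ← DiscreteGaloisModule.cohomologyMap_homOfIntertwining (W.torsionInclusion (natCast_dvd_pow_succ_cast p M)),
      hses.map_two_map_two]
    exact sub_zero z
  have hy₁loc : ∀ w : InfinitePlace K,
      galoisCohomology.localization (W.torsionGaloisModule ((p ^ (M + 1) : ℕ) : ℤ)) (Sum.inl w) 2 y₁ = 0 := fun w ↦ by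
    rw [hy₁, map_sub, localization_inl_map_two, hc₀ w (IsTotallyReal.isReal w), hr w, sub_self]
  refine ⟨galoisCohomology.map (primaryInclusion W p (M + 1)) 2 y₁, (mem_shaTwo_iff _ _).2 ?_, ?_⟩
  · rintro (w | v)
    · rw [localization_inl_map_two, hy₁loc]
      exact map_zero _
    · exact hfin v _
  · rw [← hy₁z, map_two_map_two_eq_nsmul_map_two (Summit.BirchSwinnertonDyer.Rank1Residual.X11b.Levels.levelMul W p M 1)
      (primaryInclusion W p M) (primaryInclusion W p (M + 1)) (p ^ 1)
      (Summit.BirchSwinnertonDyer.Rank1Residual.X11b.Levels.primaryInclusion_levelMul W p M 1), pow_one]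

/-- **`Ш²(K, E[p^∞]) = 0`** for `K` totally real, `Sel_{p^∞}(E/K)` finite and `E[p^∞]^{Γ_K} = 0`, granted Poitou–Tate duality
of `Ш` at finite level (`poitouTate_sha_tateDual K`, counting: FINITE, `finite_shaTwo_primary_and_natCard_le`), the two
archimedean rows AT `E[p]` (`h3`, `h2`: `p`-DIVISIBLE, above) and the vanishing of the local `H²(K_v, E[p^∞])` at finite
places. [cite: MilneADT2006, Ch. I, Thm. 4.10, Cor. 4.16, Thm. 6.13 (c)] [cite: Harari2020, Thm. 17.13 (b)] -/
theorem forall_mem_shaTwo_primary_eq_zero_at [IsTotallyReal K] (hPT : poitouTate_sha_tateDual K)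
    (h3 : ∀ c : galoisCohomology (W.torsionGaloisModule ((p : ℕ) : ℤ)) 3,
      (∀ w : InfinitePlace K, galoisCohomology.localization (W.torsionGaloisModule ((p : ℕ) : ℤ)) (Sum.inl w) 3 c = 0) →
        c = 0)
    (h2 : ∀ r : ∀ w : InfinitePlace K, galoisCohomology ((W.torsionGaloisModule ((p : ℕ) : ℤ)).toLocal (Sum.inl w)) 2,
      ∃ c : galoisCohomology (W.torsionGaloisModule ((p : ℕ) : ℤ)) 2,
        ∀ w : InfinitePlace K, w.IsReal →
          galoisCohomology.localization (W.torsionGaloisModule ((p : ℕ) : ℤ)) (Sum.inl w) 2 c = r w)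
    (hfin : ∀ (v : HeightOneSpectrum (𝓞 K))
      (Z : galoisCohomology ((LocBridge.primaryGaloisModule W p).toLocal (Sum.inr v)) 2), Z = 0)
    [Finite (W.selmerGroupPInfty p)]
    (hΓ : ∀ Q : W.geomPrimaryTorsion p, (∀ σ : absoluteGaloisGroup K, LocBridge.primaryGaloisModule W p σ Q = Q) → Q = 0) :
    ∀ c ∈ shaTwo (LocBridge.primaryGaloisModule W p), c = 0 := by
  haveI := (finite_shaTwo_primary_and_natCard_le W p hPT hΓ).1
  exact eq_zero_of_finite_of_primary_of_divisible p (shaTwo (LocBridge.primaryGaloisModule W p))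
    (fun c _ ↦ Summit.BirchSwinnertonDyer.Rank1Residual.X11b.WeakLeopoldt.exists_pow_smul_eq_zero W p c)
    (fun c hc ↦ exists_nsmul_eq_of_mem_shaTwo_at W p h3 h2 hfin c hc)

end Divisible

/-! ## §2 Over `ℚ`, `p = 2`, `GoodSS W 2`, `Γ_{ℚ_∞}` moving `E[2]`: `Ш²(ℚ, E[2^∞]) = 0` from PT(a) alone -/

section Rat

variable (W : WeierstrassCurve ℚ) [W.IsElliptic] [W.IsGloballyMinimal]

/-- **No non-zero `Γ_ℚ`-fixed point in `E[2]`** for `W/ℚ` good supersingular at `2` (`E(ℚ)[2] = 0`: X5/P2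
`irr_two_of_goodSS_two`; Galois descent `exists_toGeomPoints_eq_of_forall_smul_eq`). [cite: GreenbergLNM1716, §4 p. 119] -/
theorem exists_apply_ne_twoTorsion_of_goodSS (hss : Literature.NumberTheory.EllipticCurves.Rank1Residual.GoodSS W 2)
    (Q : W.geomTorsion ((2 : ℕ) : ℤ)) (hQ : Q ≠ 0) :
    ∃ g : absoluteGaloisGroup ℚ, W.torsionGaloisModule ((2 : ℕ) : ℤ) g Q ≠ Q := by
  have hirr := (Summit.BirchSwinnertonDyer.Rank1Residual.X5.O1.irr_two_iff_forall_two_nsmul W).mp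
    (Summit.BirchSwinnertonDyer.Rank1Residual.P2.irr_two_of_goodSS_two W hss)
  by_contra h
  push Not at h
  -- view `Q` in `E[2^∞]` and apply the tree's «`E(ℚ)[2] = 0 ⟹ E[2^∞]^{Γ_ℚ} = 0»
  have hQ2 : 2 ^ 1 • (Q : W.geomPoints) = 0 := by
    rw [pow_one]
    exact congrArg Subtype.val (SignedEC.ArchMoves.two_nsmul_twoTorsion W Q)
  set m : W.geomPrimaryTorsion 2 := ⟨Q, AddCommGroup.mem_primaryComponent.2 ⟨1, hQ2⟩⟩ with hm
  have hm0 : m = 0 :=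
    W.eq_zero_of_forall_smul_eq (p := 2) (fun P hP ↦ hirr P (by convert hP)) fun σ ↦ Subtype.ext (by
      rw [primaryComponent.coe_smul]
      change σ • ((Q : W.geomTorsion ((2 : ℕ) : ℤ)) : W.geomPoints) = Q
      rw [← Literature.NumberTheory.EllipticCurves.AddSubgroup.torsionBy.coe_smul]
      exact congrArg Subtype.val (h σ))
  have hval : ((m : W.geomPrimaryTorsion 2) : W.geomPoints) = 0 := by rw [hm0]; rfl
  exact hQ (Subtype.ext hval)

/-- **`Ш²(ℚ, E[2^∞]) = 0` on the K4 sub-row «`GoodSS W 2`, `Sel_{2^∞}(E/ℚ)` finite, `Γ_{ℚ_∞}` moves `E[2]`» from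
`poitouTate_sha_tateDual ℚ` ALONE** — the archimedean rows of skeleton v12 (`stub_poitouTateThreeRealRat`,
`stub_poitouTateTwoRealRat`) are THEOREMS at `E[2]` there (`SignedEC.ArchMoves.threeRealPlaces_twoTorsion_of_moves`,
`twoRealPlaces_twoTorsion_of_moves`). [cite: MilneADT2006, Ch. I, Thm. 4.10, Cor. 4.16, Thm. 6.13 (c)] [cite: GreenbergLNM1716, §4 p. 119] -/
theorem forall_mem_shaTwo_two_primary_eq_zero_of_goodSS_of_moves
    (hss : Literature.NumberTheory.EllipticCurves.Rank1Residual.GoodSS W 2) (hPT : poitouTate_sha_tateDual ℚ)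
    (w₀ : InfinitePlace ℚ)
    (hmove : ∃ (σ : absoluteGaloisGroup (Place.Completion (Sum.inl w₀ : Place ℚ))) (Q : W.geomTorsion ((2 : ℕ) : ℤ)),
      (W.torsionGaloisModule ((2 : ℕ) : ℤ)).toLocal (Sum.inl w₀) σ Q ≠ Q)
    [Finite (W.selmerGroupPInfty 2)] : ∀ c ∈ shaTwo (LocBridge.primaryGaloisModule W 2), c = 0 := by
  have hirr := (Summit.BirchSwinnertonDyer.Rank1Residual.X5.O1.irr_two_iff_forall_two_nsmul W).mp
    (Summit.BirchSwinnertonDyer.Rank1Residual.P2.irr_two_of_goodSS_two W hss)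
  exact forall_mem_shaTwo_primary_eq_zero_at W 2 hPT
    (SignedEC.ArchMoves.threeRealPlaces_twoTorsion_of_moves W (exists_apply_ne_twoTorsion_of_goodSS W hss) w₀ hmove)
    (SignedEC.ArchMoves.twoRealPlaces_twoTorsion_of_moves W w₀ hmove)
    (localization_inr_two_primary_eq_zero_of_goodSS W hss)
    fun Q hQ ↦ W.eq_zero_of_forall_smul_eq (p := 2) (fun P hP ↦ hirr P (by convert hP)) fun σ ↦ hQ σ

end Rat

/-! ## §3 The K4 door on the sub-row: the crux body from PT(b) and PT(a) alone -/

section Door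

/-- **K4 body on the sub-row «`Γ_{ℚ_∞}` moves `E[2]`», from the TWO generic stubs PT(b), PT(a)**: both conjuncts of the
crux `SignedControlAtTwo` for a curve of the row (`GoodSS W 2`, `a₂ = 0`) whose `2`-torsion is moved by the archimedean
decomposition group — VERBATIM the composition `signedControl_body` of skeleton `Lines/eulerchar.lean` v12 with
`shaTwoPrimaryVanishing` replaced by §2: (i) `SignedSelmerDualData.moduleFinite`; (ii) `kimControl_at_of_signedEulerCharTwo` ∘
`SignedEC.ResTwo.signedEulerChar_two_of_cassels_of_resTwo`, Cassels from `SignedEC.CasselsPT.casselsSurjectivity_H1Sigma_of_poitouTate`,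
`hres` from `SignedEC.ResTwo.resTwo_injective_of_shaTwo`.  Conditional on `poitouTate_selmerStructure_duality ℚ` and
`poitouTate_sha_tateDual ℚ` (cited, hypotheses); closes no item. [cite: MilneADT2006, Ch. I, Thm. 4.10 (a)(b)]
[cite: BDKim2013, Cor. 3.15] [cite: Kobayashi2003, Thm. 1.2] -/
theorem signedControl_body_of_moves (hPTb : poitouTate_selmerStructure_duality ℚ) (hPTa : poitouTate_sha_tateDual ℚ)
    (W : WeierstrassCurve ℚ) [W.IsElliptic] [W.IsGloballyMinimal]
    (hss : Literature.NumberTheory.EllipticCurves.Rank1Residual.GoodSS W 2) (ha : W.frobeniusTrace 2 = 0)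
    (w₀ : InfinitePlace ℚ)
    (hmove : ∃ (σ : absoluteGaloisGroup (Place.Completion (Sum.inl w₀ : Place ℚ))) (Q : W.geomTorsion ((2 : ℕ) : ℤ)),
      (W.torsionGaloisModule ((2 : ℕ) : ℤ)).toLocal (Sum.inl w₀) σ Q ≠ Q) :
    (∀ (κ : ZpExtension ℚ 2) (γ : Field.absoluteGaloisGroup ℚ), κ.IsCyclotomic → κ.IsTopGenerator γ →
        ∀ D : Kobayashi2003.SignedSelmerDualData W κ γ 1, Module.Finite (IwasawaAlgebra 2) D.X) ∧
      (∀ (κ : ZpExtension ℚ 2) (γ : Field.absoluteGaloisGroup ℚ), κ.IsCyclotomic → κ.IsTopGenerator γ →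
        ∀ (D : Kobayashi2003.SignedSelmerDualData W κ γ 1) [Module.Finite (IwasawaAlgebra 2) D.X],
          Module.IsTorsion (IwasawaAlgebra 2) D.X → ∀ g : IwasawaAlgebra 2, D.charIdeal = Ideal.span {g} →
          Finite (W.selmerGroupPInfty 2) →
          ∃ u : ℤ_[2]ˣ, ((PowerSeries.constantCoeff g : ℤ_[2]) : ℚ_[2]) =
            ((u : ℤ_[2]) : ℚ_[2]) * ((2 : ℕ) : ℚ_[2]) ^ (padicValNat 2 W.tamagawaProduct) *
              (Nat.card (W.selmerGroupPInfty 2) : ℚ_[2])) := by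
  have hC : Greenberg1999.casselsSurjectivity_H1Sigma ℚ :=
    Summit.BirchSwinnertonDyer.BirchSwinnertonDyer.Theorems.SignedEC.CasselsPT.casselsSurjectivity_H1Sigma_of_poitouTate hPTb
  refine ⟨fun _ _ _ hγ D ↦ Kobayashi2003.SignedSelmerDualData.moduleFinite hγ D, ?_⟩
  exact Summit.BirchSwinnertonDyer.BirchSwinnertonDyer.Theorems.kimControl_at_of_signedEulerCharTwo
    fun κ _ hκ hγ hSel ↦
      Summit.BirchSwinnertonDyer.BirchSwinnertonDyer.Theorems.SignedEC.ResTwo.signedEulerChar_two_of_cassels_of_resTwo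
        W κ hss ha hκ hγ hC
        (fun c hc ↦
          Summit.BirchSwinnertonDyer.BirchSwinnertonDyer.Theorems.SignedEC.ResTwo.resTwo_injective_of_shaTwo W κ hss
            (by haveI := hSel; exact forall_mem_shaTwo_two_primary_eq_zero_of_goodSS_of_moves W hss hPTa w₀ hmove) c hc)
        hSel

end Door

/-! ## §4 (appended) The whole row with the archimedean facts weakened to their `E[2]`-instances (v13-b shape) -/

section ArchAtTwoTorsion

/-- **`Ш²(ℚ, E[2^∞]) = 0` on the whole K4 row with Milne I 4.10 (c)₃ / Cor. 4.16 assumed ONLY AT `E[2]` of the row curves**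
(the `v13-b` stub shape of memo `ARCH-STUBS-AT-E2-w3g8.md`: `h3E`, `h2E` quantify over the row, not over all finite modules);
`poitouTate_sha_tateDual ℚ` by name.  On the sub-row «`Γ_{ℚ_∞}` moves `E[2]`» the two hypotheses are the theorems
`SignedEC.ArchMoves.threeRealPlaces_twoTorsion_of_moves` / `twoRealPlaces_twoTorsion_of_moves`.
[cite: MilneADT2006, Ch. I, Thm. 4.10 (a)(c), Cor. 4.16, Thm. 6.13 (c)] [cite: GreenbergLNM1716, §4 p. 119] -/
theorem stub_shaTwoPrimaryVanishing_of_poitouTate_at (hPT : poitouTate_sha_tateDual ℚ)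
    (h3E : ∀ (W : WeierstrassCurve ℚ) [W.IsElliptic] [W.IsGloballyMinimal],
      Literature.NumberTheory.EllipticCurves.Rank1Residual.GoodSS W 2 →
        ∀ c : galoisCohomology (W.torsionGaloisModule ((2 : ℕ) : ℤ)) 3,
          (∀ w : InfinitePlace ℚ, galoisCohomology.localization (W.torsionGaloisModule ((2 : ℕ) : ℤ)) (Sum.inl w) 3 c = 0) →
            c = 0)
    (h2E : ∀ (W : WeierstrassCurve ℚ) [W.IsElliptic] [W.IsGloballyMinimal],
      Literature.NumberTheory.EllipticCurves.Rank1Residual.GoodSS W 2 →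
        ∀ r : ∀ w : InfinitePlace ℚ, galoisCohomology ((W.torsionGaloisModule ((2 : ℕ) : ℤ)).toLocal (Sum.inl w)) 2,
          ∃ c : galoisCohomology (W.torsionGaloisModule ((2 : ℕ) : ℤ)) 2,
            ∀ w : InfinitePlace ℚ, w.IsReal →
              galoisCohomology.localization (W.torsionGaloisModule ((2 : ℕ) : ℤ)) (Sum.inl w) 2 c = r w) :
    ∀ (W : WeierstrassCurve ℚ) [W.IsElliptic] [W.IsGloballyMinimal],
      Literature.NumberTheory.EllipticCurves.Rank1Residual.GoodSS W 2 → W.frobeniusTrace 2 = 0 →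
        Finite (W.selmerGroupPInfty 2) → ∀ c ∈ shaTwo (LocBridge.primaryGaloisModule W 2), c = 0 :=
  fun W _ _ hss _ hSel ↦ by
    haveI := hSel
    have hirr := (Summit.BirchSwinnertonDyer.Rank1Residual.X5.O1.irr_two_iff_forall_two_nsmul W).mp
      (Summit.BirchSwinnertonDyer.Rank1Residual.P2.irr_two_of_goodSS_two W hss)
    exact forall_mem_shaTwo_primary_eq_zero_at W 2 hPT (h3E W hss) (h2E W hss)
      (localization_inr_two_primary_eq_zero_of_goodSS W hss)
      fun Q hQ ↦ W.eq_zero_of_forall_smul_eq (p := 2) (fun P hP ↦ hirr P (by convert hP)) fun σ ↦ hQ σ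

/-- **K4 body on the WHOLE row from PT(b), PT(a) and the archimedean rows AT `E[2]`** (v13-b composition: verbatim
`signedControl_body` of skeleton v12 with `shaTwoPrimaryVanishing` replaced by `stub_shaTwoPrimaryVanishing_of_poitouTate_at`).
[cite: MilneADT2006, Ch. I, Thm. 4.10] [cite: BDKim2013, Cor. 3.15] [cite: Kobayashi2003, Thm. 1.2] -/
theorem signedControl_body_of_archAtTwoTorsion (hPTb : poitouTate_selmerStructure_duality ℚ)
    (hPTa : poitouTate_sha_tateDual ℚ)
    (h3E : ∀ (W : WeierstrassCurve ℚ) [W.IsElliptic] [W.IsGloballyMinimal],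
      Literature.NumberTheory.EllipticCurves.Rank1Residual.GoodSS W 2 →
        ∀ c : galoisCohomology (W.torsionGaloisModule ((2 : ℕ) : ℤ)) 3,
          (∀ w : InfinitePlace ℚ, galoisCohomology.localization (W.torsionGaloisModule ((2 : ℕ) : ℤ)) (Sum.inl w) 3 c = 0) →
            c = 0)
    (h2E : ∀ (W : WeierstrassCurve ℚ) [W.IsElliptic] [W.IsGloballyMinimal],
      Literature.NumberTheory.EllipticCurves.Rank1Residual.GoodSS W 2 →
        ∀ r : ∀ w : InfinitePlace ℚ, galoisCohomology ((W.torsionGaloisModule ((2 : ℕ) : ℤ)).toLocal (Sum.inl w)) 2,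
          ∃ c : galoisCohomology (W.torsionGaloisModule ((2 : ℕ) : ℤ)) 2,
            ∀ w : InfinitePlace ℚ, w.IsReal →
              galoisCohomology.localization (W.torsionGaloisModule ((2 : ℕ) : ℤ)) (Sum.inl w) 2 c = r w)
    (W : WeierstrassCurve ℚ) [W.IsElliptic] [W.IsGloballyMinimal]
    (hss : Literature.NumberTheory.EllipticCurves.Rank1Residual.GoodSS W 2) (ha : W.frobeniusTrace 2 = 0) :
    (∀ (κ : ZpExtension ℚ 2) (γ : Field.absoluteGaloisGroup ℚ), κ.IsCyclotomic → κ.IsTopGenerator γ →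
        ∀ D : Kobayashi2003.SignedSelmerDualData W κ γ 1, Module.Finite (IwasawaAlgebra 2) D.X) ∧
      (∀ (κ : ZpExtension ℚ 2) (γ : Field.absoluteGaloisGroup ℚ), κ.IsCyclotomic → κ.IsTopGenerator γ →
        ∀ (D : Kobayashi2003.SignedSelmerDualData W κ γ 1) [Module.Finite (IwasawaAlgebra 2) D.X],
          Module.IsTorsion (IwasawaAlgebra 2) D.X → ∀ g : IwasawaAlgebra 2, D.charIdeal = Ideal.span {g} →
          Finite (W.selmerGroupPInfty 2) →
          ∃ u : ℤ_[2]ˣ, ((PowerSeries.constantCoeff g : ℤ_[2]) : ℚ_[2]) =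
            ((u : ℤ_[2]) : ℚ_[2]) * ((2 : ℕ) : ℚ_[2]) ^ (padicValNat 2 W.tamagawaProduct) *
              (Nat.card (W.selmerGroupPInfty 2) : ℚ_[2])) := by
  have hC : Greenberg1999.casselsSurjectivity_H1Sigma ℚ :=
    Summit.BirchSwinnertonDyer.BirchSwinnertonDyer.Theorems.SignedEC.CasselsPT.casselsSurjectivity_H1Sigma_of_poitouTate hPTb
  refine ⟨fun _ _ _ hγ D ↦ Kobayashi2003.SignedSelmerDualData.moduleFinite hγ D, ?_⟩
  exact Summit.BirchSwinnertonDyer.BirchSwinnertonDyer.Theorems.kimControl_at_of_signedEulerCharTwo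
    fun κ _ hκ hγ hSel ↦
      Summit.BirchSwinnertonDyer.BirchSwinnertonDyer.Theorems.SignedEC.ResTwo.signedEulerChar_two_of_cassels_of_resTwo
        W κ hss ha hκ hγ hC
        (fun c hc ↦
          Summit.BirchSwinnertonDyer.BirchSwinnertonDyer.Theorems.SignedEC.ResTwo.resTwo_injective_of_shaTwo W κ hss
            (stub_shaTwoPrimaryVanishing_of_poitouTate_at hPTa h3E h2E W hss ha hSel) c hc)
        hSel

/-- **K4 BY NAME (route `ThetaPartnerAtTwo` copy) from PT(b), PT(a) and the two archimedean rows AT `E[2]`** — the `v13-b` door.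
[cite: MilneADT2006, Ch. I, Thm. 4.10] -/
theorem signedControlAtTwo_of_poitouTate_two_of_archAtTwoTorsion (hPTb : poitouTate_selmerStructure_duality ℚ)
    (hPTa : poitouTate_sha_tateDual ℚ)
    (h3E : ∀ (W : WeierstrassCurve ℚ) [W.IsElliptic] [W.IsGloballyMinimal],
      Literature.NumberTheory.EllipticCurves.Rank1Residual.GoodSS W 2 →
        ∀ c : galoisCohomology (W.torsionGaloisModule ((2 : ℕ) : ℤ)) 3,
          (∀ w : InfinitePlace ℚ, galoisCohomology.localization (W.torsionGaloisModule ((2 : ℕ) : ℤ)) (Sum.inl w) 3 c = 0) →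
            c = 0)
    (h2E : ∀ (W : WeierstrassCurve ℚ) [W.IsElliptic] [W.IsGloballyMinimal],
      Literature.NumberTheory.EllipticCurves.Rank1Residual.GoodSS W 2 →
        ∀ r : ∀ w : InfinitePlace ℚ, galoisCohomology ((W.torsionGaloisModule ((2 : ℕ) : ℤ)).toLocal (Sum.inl w)) 2,
          ∃ c : galoisCohomology (W.torsionGaloisModule ((2 : ℕ) : ℤ)) 2,
            ∀ w : InfinitePlace ℚ, w.IsReal →
              galoisCohomology.localization (W.torsionGaloisModule ((2 : ℕ) : ℤ)) (Sum.inl w) 2 c = r w) :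
    Summit.BirchSwinnertonDyer.BirchSwinnertonDyer.Theses.ThetaPartnerAtTwo.SignedControlAtTwo := by
  intro W _ _ _ _ hss ha
  exact signedControl_body_of_archAtTwoTorsion hPTb hPTa h3E h2E W hss ha

/-- **K4 BY NAME (route `ResidualThetaTransportAtTwo` copy) from PT(b), PT(a) and the two archimedean rows AT `E[2]`.**
[cite: MilneADT2006, Ch. I, Thm. 4.10] -/
theorem signedControlAtTwo_rtt_of_poitouTate_two_of_archAtTwoTorsion (hPTb : poitouTate_selmerStructure_duality ℚ)
    (hPTa : poitouTate_sha_tateDual ℚ)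
    (h3E : ∀ (W : WeierstrassCurve ℚ) [W.IsElliptic] [W.IsGloballyMinimal],
      Literature.NumberTheory.EllipticCurves.Rank1Residual.GoodSS W 2 →
        ∀ c : galoisCohomology (W.torsionGaloisModule ((2 : ℕ) : ℤ)) 3,
          (∀ w : InfinitePlace ℚ, galoisCohomology.localization (W.torsionGaloisModule ((2 : ℕ) : ℤ)) (Sum.inl w) 3 c = 0) →
            c = 0)
    (h2E : ∀ (W : WeierstrassCurve ℚ) [W.IsElliptic] [W.IsGloballyMinimal],
      Literature.NumberTheory.EllipticCurves.Rank1Residual.GoodSS W 2 →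
        ∀ r : ∀ w : InfinitePlace ℚ, galoisCohomology ((W.torsionGaloisModule ((2 : ℕ) : ℤ)).toLocal (Sum.inl w)) 2,
          ∃ c : galoisCohomology (W.torsionGaloisModule ((2 : ℕ) : ℤ)) 2,
            ∀ w : InfinitePlace ℚ, w.IsReal →
              galoisCohomology.localization (W.torsionGaloisModule ((2 : ℕ) : ℤ)) (Sum.inl w) 2 c = r w) :
    Summit.BirchSwinnertonDyer.BirchSwinnertonDyer.Theses.ResidualThetaTransportAtTwo.SignedControlAtTwo := by
  intro W _ _ _ _ hss ha
  exact signedControl_body_of_archAtTwoTorsion hPTb hPTa h3E h2E W hss ha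

end ArchAtTwoTorsion

end Summit.BirchSwinnertonDyer.BirchSwinnertonDyer.Theorems.SignedEC.ShaTwoArchMoves

end
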